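import Summits.ResolutionOfSingularities.ResolutionOfSingularities.Theorems.HilbertSamuelEliminationSigmaMaxModificationsCorridor3WLadderThirdDoorClosed
import Summits.ResolutionOfSingularities.ResolutionOfSingularities.Theorems.HilbertSamuelEliminationSigmaMaxModificationsCorridor3WLadderSegmentsAssemblyB
import HarnessLib

/-!
# [OURS · L1 W4.2] THE ROW `UnitTowerExtractionLocQM` ELIMINATED FROM THE UNITS MODEL OF RECORD (b): the char row `Wlow3CharM p`, WB (moving,
# level 3) and the conjunct `SigmaMaxModificationsCorridor3` from NINE PRINTED named facts and FOUR OURS rows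
# (crux `SigmaMaxModifications` stmt-ResolutionOfSingularities-18506; conjunct `SigmaMaxModificationsCorridor3` stmt-…-19249; line `w_ladder`)

Stub worker res-L1-w42-stub-1 (gen 4). Helper file `--supports stmt-ResolutionOfSingularities-19249 --as helper`; kernel only, no new definition.
Plugs `Moving.unitTowerExtractionLocQM_of_printedFacts` (…SegmentsAssemblyB) into lead-1's `wlow3CharM_of_printed_of_constructionsLoc`,
`WB3M_of_printed_of_rowsLoc`, `sigmaMaxModificationsCorridor3_of_printed_of_rowsLoc` (…WLadderThirdDoorClosed): the OURS row
`UnitTowerExtractionLocQM p` (stub-1's unit-wise localised extraction) is now a theorem modulo {`Thm314_point_locus`, `CossartJannsenSaito2020_thm_3_14`,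
`Thm314_nearFibre_subsingleton`, `CossartJannsenSaito2020_thm_3_6`, `CossartJannsenSaito2020_thm_3_10_4`}, so the model of record reads:
PRINTED {`CossartJannsenSaito2020_nuElimination`, `CossartJannsenSaito2020SequencePermissible`, `CossartJannsenSaito2020_thm_3_10_4`,
`KeyTheorem640_char_localized_isolated`, `Corollary637_char`, `CossartJannsenSaito2020_thm_3_14`, `Thm314_point_locus`, `Thm314_nearFibre_subsingleton`,
`CossartJannsenSaito2020_thm_3_6`} + OURS rows {`Wlow3CharStrataM`, `Wlow3TwoM`, `Wtop3PointedM`, `Wtop3NonpointedM`}. CONDITIONAL on those.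

OURS bookkeeping; NOT a statement of the manuscript [Hironaka2017] nor of [CossartJannsenSaito2020]. AI-written; AI review is weaker than expert review.

References: V. Cossart, U. Jannsen, S. Saito, LNM 2270 (2020), Thm. 1.2, Thm. 3.10 (4), Thm. 3.14, Thm. 3.6, Cor. 6.37, Thm. 6.40, p. 107 [CossartJannsenSaito2020].
-/

noncomputable section

set_option linter.dupNamespace false -- namespace `…Corridor3.Moving` re-enters `…Corridor3` (module convention of the Moving files)

open CategoryTheory CategoryTheory.Limits AlgebraicGeometry TopologicalSpace IsLocalRing
open Literature.AlgebraicGeometry.Resolution Literature.RingTheory.HilbertSamuel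
open Literature.AlgebraicGeometry.CossartJannsenSaito2020
open Summit.ResolutionOfSingularities.ResolutionOfSingularities.Theses.HilbertSamuelElimination
open Summit.ResolutionOfSingularities.ResolutionOfSingularities.Theorems.CampaignW42
open Summit.ResolutionOfSingularities.ResolutionOfSingularities.Theorems.SigmaMaxModificationsCorridor3

namespace Summit.ResolutionOfSingularities.ResolutionOfSingularities.Theorems.SigmaMaxModificationsCorridor3.Moving

/-- **THE CHAR ROW `Wlow3CharM p` FROM SEVEN PRINTED FACTS AND THE STRATA HALF** (the unit-wise extraction discharged by
`Moving.unitTowerExtractionLocQM_of_printedFacts`). [cite: CossartJannsenSaito2020, Thm. 6.40, Cor. 6.37, Thm. 3.14, Thm. 3.6, Thm. 3.10 (4), p. 107] -/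
theorem wlow3CharM_of_printed_of_strataLoc (hK : KeyTheorem640_char_localized_isolated.{0})
    (h314 : CossartJannsenSaito2020_thm_3_14.{0}) (h3104 : CossartJannsenSaito2020_thm_3_10_4.{0})
    (h314pt : Thm314_point_locus.{0}) (hC637 : Corollary637_char.{0}) (h314f : Thm314_nearFibre_subsingleton.{0})
    (h36 : CossartJannsenSaito2020_thm_3_6.{0}) {p : ℕ} (hS : Wlow3CharStrataM p) : Wlow3CharM.{0} p :=
  wlow3CharM_of_printed_of_constructionsLoc hK h314 h3104 h314pt hC637 (unitTowerExtractionLocQM_of_printedFacts p h314pt h314 h314f h36 h3104) hS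

end Summit.ResolutionOfSingularities.ResolutionOfSingularities.Theorems.SigmaMaxModificationsCorridor3.Moving

namespace Summit.ResolutionOfSingularities.ResolutionOfSingularities.Theorems.SigmaMaxModificationsCorridor3.Residue

open Summit.ResolutionOfSingularities.ResolutionOfSingularities.Theorems.SigmaMaxModificationsCorridor3.Moving

/-- **WB (moving, level `3`) from SEVEN PRINTED FACTS and FOUR OURS rows.** [cite: CossartJannsenSaito2020, Thm. 3.10 (4), Thm. 6.40, Cor. 6.37, Thm. 3.14] -/
theorem WB3M_of_printed_of_rows4Loc (h310 : CossartJannsenSaito2020_thm_3_10_4.{0})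
    (hK : KeyTheorem640_char_localized_isolated.{0}) (hC : Corollary637_char.{0}) (h314 : CossartJannsenSaito2020_thm_3_14.{0})
    (h314pt : Thm314_point_locus.{0}) (h314f : Thm314_nearFibre_subsingleton.{0}) (h36 : CossartJannsenSaito2020_thm_3_6.{0})
    (hS : ∀ p : ℕ, p.Prime → Wlow3CharStrataM p) (hTwo : ∀ p : ℕ, p.Prime → Wlow3TwoM.{0} p)
    (hTopP : ∀ p : ℕ, p.Prime → Wtop3PointedM.{0} p) (hTopN : ∀ p : ℕ, p.Prime → Wtop3NonpointedM.{0} p) : WB3M :=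
  WB3M_of_printed_of_rowsLoc h310 hK hC h314 h314pt (fun p _ => unitTowerExtractionLocQM_of_printedFacts p h314pt h314 h314f h36 h310)
    hS hTwo hTopP hTopN

/-- **THE CONJUNCT `SigmaMaxModificationsCorridor3` IN THE UNITS MODEL OF RECORD (b) WITH THE EXTRACTION ROW DISCHARGED** — nine PRINTED named facts
and FOUR OURS rows {`Wlow3CharStrataM`, `Wlow3TwoM`, `Wtop3PointedM`, `Wtop3NonpointedM`}. CONDITIONAL on those.
[cite: CossartJannsenSaito2020, Thm. 1.2, Thm. 3.10 (4), Thm. 3.14, Thm. 3.6, Cor. 6.37, Thm. 6.40, p. 107] -/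
theorem sigmaMaxModificationsCorridor3_of_printed_of_rows4Loc
    (hNu : CossartJannsenSaito2020_nuElimination.{0}) (hSeq : CossartJannsenSaito2020SequencePermissible.{0})
    (h310 : CossartJannsenSaito2020_thm_3_10_4.{0}) (hK : KeyTheorem640_char_localized_isolated.{0}) (hC : Corollary637_char.{0})
    (h314 : CossartJannsenSaito2020_thm_3_14.{0}) (h314pt : Thm314_point_locus.{0}) (h314f : Thm314_nearFibre_subsingleton.{0})
    (h36 : CossartJannsenSaito2020_thm_3_6.{0})
    (hS : ∀ p : ℕ, p.Prime → Wlow3CharStrataM p) (hTwo : ∀ p : ℕ, p.Prime → Wlow3TwoM.{0} p)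
    (hTopP : ∀ p : ℕ, p.Prime → Wtop3PointedM.{0} p) (hTopN : ∀ p : ℕ, p.Prime → Wtop3NonpointedM.{0} p) : SigmaMaxModificationsCorridor3 :=
  sigmaMaxModificationsCorridor3_of_printed_of_rowsLoc hNu hSeq h310 hK hC h314 h314pt
    (fun p _ => unitTowerExtractionLocQM_of_printedFacts p h314pt h314 h314f h36 h310) hS hTwo hTopP hTopN

end Summit.ResolutionOfSingularities.ResolutionOfSingularities.Theorems.SigmaMaxModificationsCorridor3.Residue

end
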